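import Summits.AtomisticToContinuum.HydrodynamicLimit.Theses.ImplosionDichotomy
import Summits.AtomisticToContinuum.HydrodynamicLimit.Theorems.ImplosionDichotomyPolynomialCompressionIdealGasBridgeCalculus

/-!
# `ImplosionDichotomy.IdealGasImplosion` from the vendored implosion fact

Route support item stmt-AtomisticToContinuum-12588 (`IdealGasImplosion`, route `ImplosionDichotomy` of
`AtomisticToContinuum/HydrodynamicLimit`): there are continuous positive profiles `(a₀, u₀, θ₀)` on `𝕋³`
and a classical solution `(ρ₁, u₁, θ₁)` of the hard-sphere compressible Euler system at reduced
density `σ = 0` (the monatomic ideal gas, `hsPressure 0 ρ θ = ρ θ`) on some `[0, T₁)`, `T₁ > 0`, with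
data `(a₀/∫a₀, u₀, θ₀)`, whose density is unbounded on `[0, T₁)`.

The mathematical input is the smooth self-similar implosion of Cao-Labora–Gómez-Serrano–Shi–
Staffilani (arXiv:2310.05325, Thm 1.2 + Rem 1.4 (any torus size) + Rem 1.5 (Euler, `ν = 0`), with
the Buckmaster–Cao-Labora–Gómez-Serrano `γ = 5/3` profile), vendored in the tree as the NAMED FACT
`Literature.Analysis.FluidPDE.CaolaboraEtAl2025_thm12_euler γ` (a classical ISENTROPIC implosion on
the unit torus for every `γ > 1`). The bridge isentropic → full ideal-gas system
(`θ := (3/5) ρ^{2/3}`) and the unit-mass normalisation by the scaling symmetry of the isentropic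
system are the tree theorems `isHardSphereEulerSolution_zero_of_isentropic` and
`exists_smooth_isentropic_idealGasImplosion_of_thm12`
(`…Theorems.ImplosionDichotomyPolynomialCompressionIdealGasBridge{,Calculus}`).

This file records the resulting CONDITIONAL form of the item:
`idealGasImplosion_of_thm12 : CaolaboraEtAl2025_thm12_euler (5/3) → IdealGasImplosion` — the item
with the named fact as its only hypothesis (trust base: that one name). Discharging the fact
(`CaolaboraEtAl2025_thm12_euler_holds`) is the formalisation of the implosion theorem itself and is
deliberately NOT attempted here.
-/

namespace Summit.AtomisticToContinuum.HydrodynamicLimit.Theorems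

/-- **`IdealGasImplosion` conditional on the vendored implosion fact.** If the Cao-Labora–
Gómez-Serrano–Shi–Staffilani implosion holds at the monatomic exponent `γ = 5/3`
(`Literature.Analysis.FluidPDE.CaolaboraEtAl2025_thm12_euler (5/3)`: a classical isentropic Euler
solution on `[0,T) × 𝕋³` with smooth positive data and density unbounded on `[0,T)`), then there are
continuous positive profiles `(a₀, u₀, θ₀)` and a classical solution of the full ideal-gas system
`IsHardSphereEulerSolution 0 T₁ ρ₁ u₁ θ₁`, `T₁ > 0`, with data `(a₀/∫a₀, u₀, θ₀)` and density
unbounded on `[0, T₁)` — the route decl `ImplosionDichotomy.IdealGasImplosion`. Proof: forget the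
smoothness and the isentropy clause of `exists_smooth_isentropic_idealGasImplosion_of_thm12`.
[cite: CaolaboraEtAl2025, Thm 1.2 + Rem 1.4 + Rem 1.5] -/
theorem idealGasImplosion_of_thm12
    (hfact : Literature.Analysis.FluidPDE.CaolaboraEtAl2025_thm12_euler (5 / 3)) :
    Summit.AtomisticToContinuum.HydrodynamicLimit.Theses.ImplosionDichotomy.IdealGasImplosion := by
  unfold Summit.AtomisticToContinuum.HydrodynamicLimit.Theses.ImplosionDichotomy.IdealGasImplosion
  obtain ⟨a₀, θ₀, u₀, ha, hθ, hu, hapos, hθpos, T₁, K, ρ₁, θ₁, u₁, hT₁, -, hsol, hρ0, hu0, hθ0, -,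
    hunb⟩ := exists_smooth_isentropic_idealGasImplosion_of_thm12 hfact
  exact ⟨a₀, θ₀, u₀, ha.continuous, hθ.continuous, hu.continuous, hapos, hθpos, T₁, ρ₁, θ₁, u₁, hT₁,
    hsol, hρ0, hu0, hθ0, hunb⟩

end Summit.AtomisticToContinuum.HydrodynamicLimit.Theorems
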